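import Summits.QuantumFields.BalabanUV.T4Continuum.Spine.NE5.EnvelopeOnRecord
import Summits.QuantumFields.BalabanUV.T4Continuum.Support.StepRecursion

/-!
# Spine/NE5/EnvelopeOnRecordWitness — row NE5 (node U3): the H-LAYER END of record FIRES on every `R : B13Carriers.TwoRuns G`
# with a NONZERO activity family (non-vacuity of `EnvelopeOnRecord.ne5_of_leaves_fibre_activities_record_eps`)

Cell `pub-balaban-gaps` (YM blitz Y1, track G2), seat `ne5` gen 4 (`prover-pub-balaban-gaps-ne5-g4-0`), triage sheet `HOME/ne/NE5.md`
v4 §5 row E6 ∕ §10.  Imports `Spine/NE5/EnvelopeOnRecord` (gen 2 of this seat, p341430) and `Support/StepRecursion` (the runs'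
outputs DEFINED by the renormalisation-group recursion, `recA` ∕ `recB`); modifies nothing.

WHY.  The H-layer END `ne5_of_leaves_fibre_activities_record_eps` is an implication from ≈ 25 displayed binders (`hrep`, the
H-layer datum `hH`, the located numerals `κ + 128·log 162 + 2 ≤ R_d` and `C₃ε₁·e^{5κ+1}·K₀(64,8)·576 ≤ 1`, leaves L01–L03,
levels L05 ∕ L06, row NE2's rate L07, L08, the four W3 shapes L09aff ∕ L09blind ∕ L09hom ∕ L09unit, the reach clause L10, the
sharp clause `hS`).  The lineage's witnesses (`Support/B13StepEndWitness`, `Support/B13StepEnvelopeEndWitness`) concern the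
route-P1 ENDs through `Slots` and use the ZERO package; the H-layer END had no witness, and no END had one with a nonzero activity.
Here, for EVERY `R`, window `W`, `κ ≥ 0` and target rate `θ′ ∈ (½, 1]`, a step model over `R.carriers` (§2 `wModel`) whose
* activities are the NONZERO family `a·e^{−R_d·d(Z)}` (`wAct`; constant in the data — HONEST LIMITS (i)),
* output IS (2.13) of them on Bałaban's torus catalogue (`locE` over `tsys 4 (R.cubesPerDir j)`; `hrep` by `rfl`),
* two runs DIFFER in operator data by exactly `δ·θ^k` margins, `δ > 0` (row NE2's shape L07 non-trivially),
* history insertions are the NONZERO linear table-driven maps `wIns` (gain `c_H > 0`, channel weight `ω = ½`; the W3 shapes and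
  both runs' blindness non-trivially, on the real domain type `Σ j, TDom 4 (R.cubesPerDir j)`),
* outputs are `recA` ∕ `recB` (L01 ∕ L02 by `StepRecursion.representsA_recA` ∕ `representsB_recB`), and whose
* LEVELS L05 ∕ L06 are OBTAINED FROM the kernel W2 theorem `outputEnvelope_of_activities_record` (§3, not assumed),
discharges every binder: `end_fires` (∃ C₅, NE5 (recA M) (recB M) W κ θ′ C₅ under three displayed smallness clauses on `a, δ, c_H`)
and `exists_end_fires` (explicit POSITIVE `a, δ, c_H` for every `θ′ ∈ (½, 1]`).  So the END's binder list has no hidden clash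
(signs, located numerals, the `G∕(1−ρ₀)` smallness, the W3 shapes against a genuinely table-driven insertion).

HONEST LIMITS.  (i) The activity is CONSTANT in the data: with `Base := univ` the datum `hH` asks for ONE bound on a neighbourhood
of every box, i.e. on all of `Op × Hist`, and a bounded entire function is constant — a data-DEPENDENT witness needs a bounded
admissible class and the scale induction on levels (companion file).  (ii) Nothing of [Balaban1988RG2Cluster]'s objects is
modelled: `Op = Hist = ℂ`; activities, operator data and insertions are toys; the torus catalogue, `locE`, the tree length and the
numerals are the tree's.  (iii) NE5 (`T4OutputRate.NE5`) is a cell NEW ESTIMATE — NOT PRINTED (GAPS G-t4-U3-1) and NOT PROVED;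
0∕12 leaves on Bałaban's objects; spine PROVED 0∕9; rung (B)+1 bookkeeping on a FIXED finite T⁴ — NOT the continuum limit, NOT
infinite volume, NOT a mass gap, NOT Clay.  HONEST DEPENDENCY: continuum YM on T⁴ ⇐ BetaPertH ∧ nine spine estimates (0/9
proved); BetaPertH ⇐ (D1) ∧ (D4) ∧ CAP+tail.  0 sorry; axioms standard; no cite tags (nothing printed is asserted).
-/

noncomputable section

open Set Metric
open scoped BigOperators

namespace Summit.QuantumFields.BalabanUV.T4Continuum.Spine.NE5.EnvelopeOnRecordWitness

open Literature.MathematicalPhysics.QuantumFieldTheory.Balaban1983to89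
open Literature.MathematicalPhysics.QuantumFieldTheory.Balaban1983to89.T4OutputRate
open Literature.MathematicalPhysics.QuantumFieldTheory.Balaban1983to89.T4InputCauchyRateData
open Literature.MathematicalPhysics.QuantumFieldTheory.Balaban1983to89.B13Resummation (locE)
open Literature.MathematicalPhysics.QuantumFieldTheory.Balaban1983to89.TreeLengthTorus (TPt TDom tsys torusTreeLen)
open Literature.MathematicalPhysics.QuantumFieldTheory.Balaban1983to89.TreeLengthTorusGeometry (TTouch)
open Literature.MathematicalPhysics.QuantumFieldTheory.Balaban1983to89.B12TreeDecay (K₀ K₀_pos)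
open Summit.QuantumFields.BalabanUV.T4Continuum.B13Carriers (TwoRuns)
open Summit.QuantumFields.BalabanUV.T4Continuum.StepRecursion
open Summit.QuantumFields.BalabanUV.T4Continuum.Spine.NE5

variable {G : Type} [GaugeGroup G] (R : TwoRuns G)

/-! ## §1 The toy data: nonzero constant activities, geometrically separated operator data, linear history insertions -/

/-- [folklore] The witness ACTIVITY at scale `j`: `Z ↦ a·e^{−R_d·d(Z)}` (real, as a complex number), constant in the data. -/
def wAct (a Rd : ℝ) (j : ℕ) (Z : TDom 4 (R.cubesPerDir j)) : ℂ :=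
  ((a * Real.exp (-(Rd * torusTreeLen Z.1)) : ℝ) : ℂ)

/-- [folklore] The same as a DATA-INDEXED family — the shape `act` of the END's `hrep` ∕ `hH` (data argument ignored). -/
def wActD (a Rd : ℝ) : (j : ℕ) → ℂ × ℂ → TDom 4 (R.cubesPerDir j) → ℂ := fun j _ Z => wAct R a Rd j Z

/-- [folklore] The witness activity is nonzero when `a ≠ 0`. -/
theorem wAct_ne_zero {a : ℝ} (ha : a ≠ 0) (Rd : ℝ) (j : ℕ) (Z : TDom 4 (R.cubesPerDir j)) : wAct R a Rd j Z ≠ 0 := by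
  simpa only [wAct, ne_eq, Complex.ofReal_eq_zero, mul_eq_zero, Real.exp_ne_zero, or_false] using ha
/-- [folklore] Its norm is `a·e^{−R_d·d(Z)}` for `a ≥ 0`. -/
theorem norm_wAct {a : ℝ} (ha : 0 ≤ a) (Rd : ℝ) (j : ℕ) (Z : TDom 4 (R.cubesPerDir j)) :
    ‖wAct R a Rd j Z‖ = a * Real.exp (-(Rd * torusTreeLen Z.1)) := by
  rw [wAct, Complex.norm_real, Real.norm_eq_abs, abs_of_nonneg (mul_nonneg ha (Real.exp_pos _).le)]

/-- [folklore] The scale-`j` WEIGHTED AVERAGE of a table on the carriers of record: `Σ_{X ∈ 𝐃_j} e^{κ d(X)}∕#𝐃_j · t ⟨j, X⟩`. -/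
def scaleAvg (κ : ℝ) (j : ℕ) (t : R.carriers.Dom → ℝ) : ℝ :=
  ∑ X : TDom 4 (R.cubesPerDir j), Real.exp (κ * torusTreeLen X.1) / (Fintype.card (TDom 4 (R.cubesPerDir j)) : ℝ) * t (R.mkDom j X)

/-- [folklore] The average is additive in the table. -/
theorem scaleAvg_sub (κ : ℝ) (j : ℕ) (t t' : R.carriers.Dom → ℝ) :
    scaleAvg R κ j (t - t') = scaleAvg R κ j t - scaleAvg R κ j t' := by
  simp only [scaleAvg, Pi.sub_apply, mul_sub, Finset.sum_sub_distrib]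
/-- [folklore] The average is homogeneous in the table. -/
theorem scaleAvg_smul (κ : ℝ) (j : ℕ) (c : ℝ) (t : R.carriers.Dom → ℝ) :
    scaleAvg R κ j (c • t) = c * scaleAvg R κ j t := by
  simp only [scaleAvg, Pi.smul_apply, smul_eq_mul, Finset.mul_sum]
  exact Finset.sum_congr rfl fun X _ => by ring
/-- [folklore] The average of the zero table vanishes. -/
theorem scaleAvg_zero (κ : ℝ) (j : ℕ) : scaleAvg R κ j 0 = 0 := by simp [scaleAvg]

/-- [folklore] The average reads the table at scale `j` only. -/
theorem scaleAvg_congr (κ : ℝ) (j : ℕ) {t t' : R.carriers.Dom → ℝ}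
    (h : ∀ X : TDom 4 (R.cubesPerDir j), t (R.mkDom j X) = t' (R.mkDom j X)) :
    scaleAvg R κ j t = scaleAvg R κ j t' := by
  simp only [scaleAvg, h]

/-- [folklore] `#𝐃_j > 0`: every cube is a localization domain (`B13Carriers.singleDom`). -/
theorem card_tdom_pos (j : ℕ) : 0 < (Fintype.card (TDom 4 (R.cubesPerDir j)) : ℝ) := by
  haveI : Nonempty (TDom 4 (R.cubesPerDir j)) := ⟨B13Carriers.singleDom 0⟩
  exact_mod_cast Fintype.card_pos

/-- [folklore] THE SIZE BOUND of the average: a scale-`j` table with entries `|t ⟨j, X⟩| ≤ T·e^{−κ d(X)}` averages to at most `T`. -/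
theorem abs_scaleAvg_le (κ : ℝ) (j : ℕ) {t : R.carriers.Dom → ℝ} {T : ℝ}
    (ht : ∀ X : TDom 4 (R.cubesPerDir j), |t (R.mkDom j X)| ≤ T * Real.exp (-(κ * torusTreeLen X.1))) :
    |scaleAvg R κ j t| ≤ T := by
  have hc := card_tdom_pos R j
  unfold scaleAvg
  refine (Finset.abs_sum_le_sum_abs _ _).trans ?_
  calc ∑ X : TDom 4 (R.cubesPerDir j), |Real.exp (κ * torusTreeLen X.1) / (Fintype.card (TDom 4 (R.cubesPerDir j)) : ℝ) *
          t (R.mkDom j X)|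
      ≤ ∑ _X : TDom 4 (R.cubesPerDir j), T / (Fintype.card (TDom 4 (R.cubesPerDir j)) : ℝ) := by
        refine Finset.sum_le_sum fun X _ => ?_
        rw [abs_mul, abs_of_nonneg (div_nonneg (Real.exp_pos _).le hc.le)]
        calc Real.exp (κ * torusTreeLen X.1) / (Fintype.card (TDom 4 (R.cubesPerDir j)) : ℝ) * |t (R.mkDom j X)|
            ≤ Real.exp (κ * torusTreeLen X.1) / (Fintype.card (TDom 4 (R.cubesPerDir j)) : ℝ) *
                (T * Real.exp (-(κ * torusTreeLen X.1))) :=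
              mul_le_mul_of_nonneg_left (ht X) (div_nonneg (Real.exp_pos _).le hc.le)
          _ = T / (Fintype.card (TDom 4 (R.cubesPerDir j)) : ℝ) := by
              rw [Real.exp_neg]
              field_simp
    _ = T := by
        rw [Finset.sum_const, Finset.card_univ, nsmul_eq_mul]
        field_simp

/-- [folklore] The witness HISTORY INSERTION at step `k`: `t ↦ c_H · Σ_{j<k} (½)^{k−1−j} · scaleAvg_j t` — table-driven, linear, blind
to scales `≥ k`, with the printed channel weight `ω = ½` per scale of age. -/
def wIns (κ cH : ℝ) (k : ℕ) (t : R.carriers.Dom → ℝ) : ℂ :=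
  ((cH * ∑ j ∈ Finset.range k, (1 / 2 : ℝ) ^ (k - 1 - j) * scaleAvg R κ j t : ℝ) : ℂ)

/-- [folklore] The insertion of the zero table vanishes. -/
theorem wIns_zero (κ cH : ℝ) (k : ℕ) : wIns R κ cH k 0 = 0 := by simp [wIns, scaleAvg_zero]
/-- [folklore] The insertion is additive. -/
theorem wIns_sub (κ cH : ℝ) (k : ℕ) (t t' : R.carriers.Dom → ℝ) :
    wIns R κ cH k (t - t') = wIns R κ cH k t - wIns R κ cH k t' := by
  simp only [wIns, scaleAvg_sub, mul_sub, Finset.sum_sub_distrib, Complex.ofReal_sub]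

/-- [folklore] The insertion is homogeneous. -/
theorem wIns_smul (κ cH : ℝ) (k : ℕ) (c : ℝ) (t : R.carriers.Dom → ℝ) :
    wIns R κ cH k (c • t) = (c : ℂ) * wIns R κ cH k t := by
  simp only [wIns, scaleAvg_smul, ← Complex.ofReal_mul]
  congr 1
  rw [Finset.mul_sum, Finset.mul_sum, Finset.mul_sum]
  exact Finset.sum_congr rfl fun j _ => by ring

/-- [folklore] The insertion at step `k` reads table entries of scale `< k` only. -/
theorem wIns_congr (κ cH : ℝ) (k : ℕ) {t t' : R.carriers.Dom → ℝ}
    (h : ∀ Y : R.carriers.Dom, R.carriers.scale Y < k → t Y = t' Y) :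
    wIns R κ cH k t = wIns R κ cH k t' := by
  unfold wIns
  congr 2
  refine Finset.sum_congr rfl fun j hj => ?_
  rw [scaleAvg_congr R κ j fun X => h (R.mkDom j X) (by rw [R.scale_mkDom]; exact Finset.mem_range.1 hj)]

/-- [folklore] THE SINGLE-SCALE SIZE BOUND (shape of `StepModel.InsScaleBound`): a table supported on ONE scale `j < k` with entries
`≤ T·e^{−κ d}` moves the step-`k` insertion by at most `c_H·(½)^{k−1−j}·T`. -/
theorem norm_wIns_le {κ cH : ℝ} (hcH : 0 ≤ cH) {k j : ℕ} (hjk : j < k) {t : R.carriers.Dom → ℝ} {T : ℝ}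
    (hsupp : ∀ Y : R.carriers.Dom, R.carriers.scale Y ≠ j → t Y = 0)
    (hsize : ∀ Y : R.carriers.Dom, R.carriers.scale Y = j → |t Y| ≤ T * Real.exp (-(κ * R.carriers.d Y))) :
    ‖wIns R κ cH k t‖ ≤ cH * ((1 / 2 : ℝ) ^ (k - 1 - j) * T) := by
  have hsum : ∑ i ∈ Finset.range k, (1 / 2 : ℝ) ^ (k - 1 - i) * scaleAvg R κ i t =
      (1 / 2 : ℝ) ^ (k - 1 - j) * scaleAvg R κ j t := by
    refine Finset.sum_eq_single j (fun i _ hij => ?_) (fun hj => absurd (Finset.mem_range.2 hjk) hj)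
    have h0 : scaleAvg R κ i t = 0 := by
      rw [← scaleAvg_zero R κ i]
      exact scaleAvg_congr R κ i fun X => hsupp (R.mkDom i X) (by rw [R.scale_mkDom]; exact hij)
    rw [h0, mul_zero]
  have havg : |scaleAvg R κ j t| ≤ T :=
    abs_scaleAvg_le R κ j fun X => by
      have h := hsize (R.mkDom j X) (R.scale_mkDom j X)
      rwa [R.d_mkDom] at h
  rw [wIns, hsum, Complex.norm_real, Real.norm_eq_abs, abs_mul, abs_of_nonneg hcH, abs_mul,
    abs_of_nonneg (pow_nonneg (by norm_num) _)]
  exact mul_le_mul_of_nonneg_left (mul_le_mul_of_nonneg_left havg (pow_nonneg (by norm_num) _)) hcH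

/-! ## §2 The witness step model over the carriers of record -/

variable [∀ j, DecidableEq (TDom 4 (R.cubesPerDir j))] [∀ j, DecidableRel (TTouch (d := 4) (N := R.cubesPerDir j))]

/-- [folklore] **THE WITNESS STEP MODEL** over `R.carriers` with `Op = Hist = ℂ`: output := (2.13) of the activities `wAct` on the
scale-`j` torus catalogue (the definition the END's `hrep` asks for); run A's operator datum `δ·θ^k`, run B's `0`; both runs insert
histories by `wIns`; admissible class = everything; unit margins. -/
def wModel (a Rd κ δ θ cH : ℝ) : StepModel R.carriers ℂ ℂ where
  Out := fun _ _ _ X =>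
    locE (TTouch (d := 4) (N := R.cubesPerDir X.1)) (fun Z : (tsys 4 (R.cubesPerDir X.1)).Dom => Z.1) (wAct R a Rd X.1) X.2.1
  opA := fun _ _ k => ((δ * θ ^ k : ℝ) : ℂ)
  opB := fun _ _ _ => 0
  insA := fun _ _ k t => wIns R κ cH k t
  insB := fun _ _ k t => wIns R κ cH k t
  Base := fun _ _ _ => Set.univ
  rOp := fun _ => 1
  rHist := fun _ => 1
  rOp_pos := fun _ => one_pos
  rHist_pos := fun _ => one_pos
set_option maxHeartbeats 400000 in
/-- [folklore] `hrep` of the END: the model's output IS (2.13) of the (data-independent) activities `wActD` — by `rfl`. -/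
theorem hrep_wModel (a Rd κ δ θ cH : ℝ) : ∀ (X : R.carriers.Dom) (z : ℂ × ℂ),
    (wModel R a Rd κ δ θ cH).Out X.1 z.1 z.2 X =
      locE (TTouch (d := 4) (N := R.cubesPerDir X.1)) (fun Z : (tsys 4 (R.cubesPerDir X.1)).Dom => Z.1)
        (wActD R a Rd X.1 z) X.2.1 :=
  fun _ _ => rfl

/-- [folklore] `hH` of the END (the H-LAYER DATUM) for the constant activity at majorant constant `A = a`: on `V := univ` every
activity is ℂ-differentiable in the data (constant) and dominated by `a·e^{−R_d·d(Z)}`. -/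
theorem hH_wModel {a : ℝ} (ha : 0 ≤ a) (Rd κ δ θ cH : ℝ) (W : Set (ℕ → ℝ)) :
    ∀ j, ∀ g ∈ W, ∀ (U : R.carriers.BgB) (p : ℂ × ℂ), p ∈ (wModel R a Rd κ δ θ cH).Base j g U →
      ∃ V : Set (ℂ × ℂ), IsOpen V ∧ (wModel R a Rd κ δ θ cH).box j p ⊆ V ∧
        (∀ Z : TDom 4 (R.cubesPerDir j), DifferentiableOn ℂ (fun z : ℂ × ℂ => wActD R a Rd j z Z) V) ∧
        (∀ z ∈ V, ∀ Z : TDom 4 (R.cubesPerDir j), ‖wActD R a Rd j z Z‖ ≤ a * Real.exp (-(Rd * torusTreeLen Z.1))) := by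
  intro j g _ U p _
  refine ⟨univ, isOpen_univ, subset_univ _, fun Z => differentiableOn_const _, fun z _ Z => ?_⟩
  exact (norm_wAct R ha Rd j Z).le

/-- [folklore] `ReadsTransported`: run A's data do not depend on the background at all. -/
theorem readsTransported_wModel {a Rd κ δ θ cH : ℝ} (W : Set (ℕ → ℝ)) : ReadsTransported (wModel R a Rd κ δ θ cH) W :=
  fun _ _ _ _ _ => ⟨fun _ => rfl, fun _ _ => rfl⟩

/-- [folklore] L09blind: run A's insertion reads earlier scales only. -/
theorem insBlind_wModel {a Rd κ δ θ cH : ℝ} (W : Set (ℕ → ℝ)) : (wModel R a Rd κ δ θ cH).InsBlind W :=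
  fun k _ _ _ _ _ h => wIns_congr R κ cH k h

/-- [folklore] Run B's insertion reads earlier scales only (`StepRecursion.InsBlindB`). -/
theorem insBlindB_wModel {a Rd κ δ θ cH : ℝ} (W : Set (ℕ → ℝ)) : InsBlindB (wModel R a Rd κ δ θ cH) W :=
  fun k _ _ _ _ _ h => wIns_congr R κ cH k h

/-- [folklore] L09aff: the insertion is affine in the table. -/
theorem insAffine_wModel {a Rd κ δ θ cH : ℝ} (W : Set (ℕ → ℝ)) : (wModel R a Rd κ δ θ cH).InsAffine W := by
  intro k g _ U t t'
  change wIns R κ cH k t - wIns R κ cH k t' = wIns R κ cH k (t - t') - wIns R κ cH k 0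
  rw [wIns_sub, wIns_zero, sub_zero]

/-- [folklore] L09hom: the table-driven part is ℝ-homogeneous. -/
theorem insHomog_wModel {a Rd κ δ θ cH : ℝ} (W : Set (ℕ → ℝ)) : (wModel R a Rd κ δ θ cH).InsHomog W := by
  intro k g _ U c t
  change wIns R κ cH k (c • t) - wIns R κ cH k 0 = (c : ℂ) • (wIns R κ cH k t - wIns R κ cH k 0)
  rw [wIns_smul, wIns_zero, sub_zero, sub_zero, smul_eq_mul]

/-- [folklore] L09unit (`InsScaleBound W κ E₁ c_H ½`) for EVERY level `E₁`: the printed single-scale shape, non-trivially (`c_H > 0`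
allowed). -/
theorem insScaleBound_wModel {a Rd κ δ θ cH : ℝ} (hcH : 0 ≤ cH) (W : Set (ℕ → ℝ)) (E₁ : ℝ) :
    (wModel R a Rd κ δ θ cH).InsScaleBound W κ E₁ cH (1 / 2) := by
  intro k g _ U t j hjk hsupp hsize
  change ‖wIns R κ cH k t - wIns R κ cH k 0‖ ≤ 1 * (cH * ((1 / 2 : ℝ) ^ (k - 1 - j) * E₁))
  rw [wIns_zero, sub_zero, one_mul]
  exact norm_wIns_le R hcH hjk hsupp hsize

/-- [folklore] L07 (row NE2's shape `OperatorRate W δ θ`) NON-TRIVIALLY: the two runs' operator data differ by EXACTLY `δ·θ^k`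
operator margins. -/
theorem operatorRate_wModel {a Rd κ δ θ cH : ℝ} (hδ : 0 ≤ δ) (hθ : 0 ≤ θ) (W : Set (ℕ → ℝ)) :
    (wModel R a Rd κ δ θ cH).OperatorRate W δ θ := by
  intro k g _ U
  change ‖((δ * θ ^ k : ℝ) : ℂ) - 0‖ ≤ δ * θ ^ k * 1
  rw [sub_zero, Complex.norm_real, Real.norm_eq_abs, abs_of_nonneg (mul_nonneg hδ (pow_nonneg hθ _)), mul_one]

/-- [folklore] L08 (`InsertionRate W κ E₀ 0 θ`): the two runs insert identically. -/
theorem insertionRate_wModel {a Rd κ δ θ cH : ℝ} (W : Set (ℕ → ℝ)) (E₀ θ' : ℝ) :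
    (wModel R a Rd κ δ θ cH).InsertionRate W κ E₀ 0 θ' := by
  intro k g _ U t _
  change ‖wIns R κ cH k t - wIns R κ cH k t‖ ≤ 0 * θ' ^ k * 1
  rw [sub_self, norm_zero, zero_mul, zero_mul]

/-- [folklore] L03 (`InBase`): every data point is admissible. -/
theorem inBase_wModel {a Rd κ δ θ cH : ℝ} (W : Set (ℕ → ℝ)) (EB : Functional R.carriers R.carriers.BgB) :
    (wModel R a Rd κ δ θ cH).InBase EB W :=
  fun _ _ _ _ => Set.mem_univ _

/-! ## §3 Levels FROM the kernel W2 theorem: the envelope bounds every output, hence the recursive outputs of both runs -/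

/-- [folklore] THE OUTPUT ENVELOPE OF THE WITNESS MODEL, FROM THE TREE'S W2 THEOREM: under the two located one-run clauses,
`EnvelopeOnRecord.outputEnvelope_of_activities_record` gives `OutputEnvelope W κ (e·9·64·K₀(64,8)²·a)` (the [KP86] ∕ (2.41) content
is the tree's, not re-proved). -/
theorem outputEnvelope_wModel {a κ : ℝ} (ha : 0 ≤ a) (hκ : 0 ≤ κ) {Rd : ℝ} (hrate : κ + 2 * (64 * Real.log 162) + 2 ≤ Rd)
    (hKP : a * Real.exp (5 * κ + 1) * K₀ 64 8 * 9 * 64 ≤ 1) (δ θ cH : ℝ) (W : Set (ℕ → ℝ)) :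
    (wModel R a Rd κ δ θ cH).OutputEnvelope W κ (Real.exp 1 * 9 * 64 * K₀ 64 8 ^ 2 * a) :=
  outputEnvelope_of_activities_record R (wModel R a Rd κ δ θ cH) (act := wActD R a Rd) (hrep_wModel R a Rd κ δ θ cH)
    ha hκ hrate hKP (hH_wModel R ha Rd κ δ θ cH W)

/-- [folklore] Hence EVERY output of the witness model is at most `G_w·e^{−κ d(X)}` (every data point is a base point in its own box). -/
theorem norm_out_le {a κ : ℝ} (ha : 0 ≤ a) (hκ : 0 ≤ κ) {Rd : ℝ} (hrate : κ + 2 * (64 * Real.log 162) + 2 ≤ Rd)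
    (hKP : a * Real.exp (5 * κ + 1) * K₀ 64 8 * 9 * 64 ≤ 1) (δ θ cH : ℝ) {W : Set (ℕ → ℝ)} {g : ℕ → ℝ} (hg : g ∈ W)
    (U : R.carriers.BgB) (z : ℂ × ℂ) (X : R.carriers.Dom) :
    ‖(wModel R a Rd κ δ θ cH).Out X.1 z.1 z.2 X‖ ≤
      Real.exp 1 * 9 * 64 * K₀ 64 8 ^ 2 * a * Real.exp (-(κ * R.carriers.d X)) := by
  have henv := outputEnvelope_wModel R ha hκ hrate hKP δ θ cH W X.1 g hg U z (Set.mem_univ z) X rfl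
  have hz : z ∈ (wModel R a Rd κ δ θ cH).box X.1 z :=
    Set.mk_mem_prod (mem_closedBall_self zero_le_one) (mem_closedBall_self zero_le_one)
  exact henv.2 z hz

/-- [folklore] Hence run B's step map on tables is bounded by the same envelope, whatever the table. -/
theorem abs_stepMapB_le {a κ : ℝ} (ha : 0 ≤ a) (hκ : 0 ≤ κ) {Rd : ℝ} (hrate : κ + 2 * (64 * Real.log 162) + 2 ≤ Rd)
    (hKP : a * Real.exp (5 * κ + 1) * K₀ 64 8 * 9 * 64 ≤ 1) (δ θ cH : ℝ) {W : Set (ℕ → ℝ)} {g : ℕ → ℝ} (hg : g ∈ W)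
    (U : R.carriers.BgB) (t : R.carriers.Dom → ℝ) (X : R.carriers.Dom) :
    |stepMapB (wModel R a Rd κ δ θ cH) g U t X| ≤ Real.exp 1 * 9 * 64 * K₀ 64 8 ^ 2 * a * Real.exp (-(κ * R.carriers.d X)) :=
  (Complex.abs_re_le_norm _).trans
    (norm_out_le R ha hκ hrate hKP δ θ cH hg U
      ((wModel R a Rd κ δ θ cH).opB g U (R.carriers.scale X), (wModel R a Rd κ δ θ cH).insB g U (R.carriers.scale X) t) X)

/-- [folklore] … and run A's. -/
theorem abs_stepMapA_le {a κ : ℝ} (ha : 0 ≤ a) (hκ : 0 ≤ κ) {Rd : ℝ} (hrate : κ + 2 * (64 * Real.log 162) + 2 ≤ Rd)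
    (hKP : a * Real.exp (5 * κ + 1) * K₀ 64 8 * 9 * 64 ≤ 1) (δ θ cH : ℝ) {W : Set (ℕ → ℝ)} {g : ℕ → ℝ} (hg : g ∈ W)
    (U : R.carriers.BgB) (t : R.carriers.Dom → ℝ) (X : R.carriers.Dom) :
    |stepMapA (wModel R a Rd κ δ θ cH) g U t X| ≤ Real.exp 1 * 9 * 64 * K₀ 64 8 ^ 2 * a * Real.exp (-(κ * R.carriers.d X)) :=
  (Complex.abs_re_le_norm _).trans
    (norm_out_le R ha hκ hrate hKP δ θ cH hg U
      ((wModel R a Rd κ δ θ cH).opA g U (R.carriers.scale X), (wModel R a Rd κ δ θ cH).insA g U (R.carriers.scale X) t) X)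

/-- [folklore] **L06 FROM THE ENVELOPE**: run B's recursively DEFINED output obeys the one-run level `E₀ = G_w`. -/
theorem decayBound_recB {a κ : ℝ} (ha : 0 ≤ a) (hκ : 0 ≤ κ) {Rd : ℝ} (hrate : κ + 2 * (64 * Real.log 162) + 2 ≤ Rd)
    (hKP : a * Real.exp (5 * κ + 1) * K₀ 64 8 * 9 * 64 ≤ 1) (δ θ cH : ℝ) (W : Set (ℕ → ℝ)) :
    DecayBound (recB (wModel R a Rd κ δ θ cH)) W (Real.exp 1 * 9 * 64 * K₀ 64 8 ^ 2 * a) κ := by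
  intro g hg U X
  change |((stepMapB (wModel R a Rd κ δ θ cH) g U)^[R.carriers.scale X + 1]) 0 X| ≤ _
  rw [Function.iterate_succ_apply']
  exact abs_stepMapB_le R ha hκ hrate hKP δ θ cH hg U _ X

/-- [folklore] **L05 FROM THE ENVELOPE**: run A's recursively DEFINED output obeys the level `EA₀ = G_w` (off the image of the
transport it is `0` by definition). -/
theorem decayBound_recA {a κ : ℝ} (ha : 0 ≤ a) (hκ : 0 ≤ κ) {Rd : ℝ} (hrate : κ + 2 * (64 * Real.log 162) + 2 ≤ Rd)
    (hKP : a * Real.exp (5 * κ + 1) * K₀ 64 8 * 9 * 64 ≤ 1) (δ θ cH : ℝ) (W : Set (ℕ → ℝ)) :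
    DecayBound (recA (wModel R a Rd κ δ θ cH)) W (Real.exp 1 * 9 * 64 * K₀ 64 8 ^ 2 * a) κ := by
  intro g hg V X
  unfold recA
  split_ifs with h
  · change |((stepMapA (wModel R a Rd κ δ θ cH) g (Classical.choose h))^[R.carriers.scale X + 1]) 0 X| ≤ _
    rw [Function.iterate_succ_apply']
    exact abs_stepMapA_le R ha hκ hrate hKP δ θ cH hg _ _ X
  · rw [abs_zero]
    have : 0 ≤ K₀ 64 8 := (K₀_pos 64 8).le
    positivity

/-! ## §4 THE END FIRES -/

/-- **THE H-LAYER END OF RECORD FIRES ON EVERY PAIR OF RUNS, WITH NONZERO ACTIVITIES, THROUGH THE KERNEL W2 THEOREM.**  For every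
`R`, window `W`, `κ ≥ 0`, rates `0 ≤ θ ≤ θ′ ≤ 1` and letters `a, δ, c_H ≥ 0` obeying the [KP86] clause in located numerals, the reach
clause L10 and the sharp clause `hS`, the END `ne5_of_leaves_fibre_activities_record_eps` applied to `wModel` (`R_d := κ + 128·log 162 + 2`,
`C₃ := a`, `ε₁ := 1`, `δ′ := 0`, `ω := ρ₀ := ½`, `k₀ := 0`, `B := 0`, `E₁ := 1`, `EA₀ = E₀ := G_w`) with EVERY binder discharged (§2–§3)
yields NE5 for the recursively defined outputs of the two runs. [folklore] -/
theorem end_fires {W : Set (ℕ → ℝ)} {a κ δ θ θ' cH : ℝ} (ha : 0 ≤ a) (hκ : 0 ≤ κ) (hδ : 0 ≤ δ) (hθ : 0 ≤ θ)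
    (hθθ' : θ ≤ θ') (hθ'1 : θ' ≤ 1) (hcH : 0 ≤ cH)
    (hKP : a * Real.exp (5 * κ + 1) * K₀ 64 8 * 9 * 64 ≤ 1)
    (hnear : δ + cH * (Real.exp 1 * 9 * 64 * K₀ 64 8 ^ 2 * a + Real.exp 1 * 9 * 64 * K₀ 64 8 ^ 2 * a) / (1 - 1 / 2) ≤ 1 / 2)
    (hS : Real.exp 1 * 9 * 64 * K₀ 64 8 ^ 2 * a * cH < (θ' - 1 / 2) * (1 - 1 / 2)) :
    ∃ C₅ : ℝ, NE5 (recA (wModel R a (κ + 2 * (64 * Real.log 162) + 2) κ δ θ cH))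
      (recB (wModel R a (κ + 2 * (64 * Real.log 162) + 2) κ δ θ cH)) W κ θ' C₅ := by
  have hrate : κ + 2 * (64 * Real.log 162) + 2 ≤ κ + 2 * (64 * Real.log 162) + 2 := le_rfl
  have hKP' : a * 1 * Real.exp (5 * κ + 1) * K₀ 64 8 * 9 * 64 ≤ 1 := by rw [mul_one]; exact hKP
  have hS' : Real.exp 1 * 9 * 64 * K₀ 64 8 ^ 2 * a * cH * 1 < (θ' - 1 / 2) * (1 - 1 / 2) := by rw [mul_one]; exact hS
  have hnear' : (δ + 0) * θ ^ (0 : ℕ) +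
      cH * (Real.exp 1 * 9 * 64 * K₀ 64 8 ^ 2 * a + Real.exp 1 * 9 * 64 * K₀ 64 8 ^ 2 * a) / (1 - 1 / 2) ≤ 1 / 2 := by
    rw [add_zero, pow_zero, mul_one]; exact hnear
  have hfirst : ∀ k < (0 : ℕ), Real.exp 1 * 9 * 64 * K₀ 64 8 ^ 2 * a + Real.exp 1 * 9 * 64 * K₀ 64 8 ^ 2 * a ≤ 0 * θ ^ k :=
    fun k hk => absurd hk (Nat.not_lt_zero k)
  exact ⟨_, ne5_of_leaves_fibre_activities_record_eps R (wModel R a (κ + 2 * (64 * Real.log 162) + 2) κ δ θ cH)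
    (act := wActD R a (κ + 2 * (64 * Real.log 162) + 2))
    (hrep_wModel R a _ κ δ θ cH) ha zero_le_one hκ hrate hKP'
    (fun j g hg U p hp => by
      obtain ⟨V, h1, h2, h3, h4⟩ := hH_wModel R ha _ κ δ θ cH W j g hg U p hp
      exact ⟨V, h1, h2, h3, fun z hz Z => by rw [mul_one]; exact h4 z hz Z⟩)
    (representsA_recA (insBlind_wModel R W) (readsTransported_wModel R W))
    (representsB_recB (insBlindB_wModel R W))
    (inBase_wModel R W _)
    (decayBound_recA R ha hκ hrate hKP δ θ cH W) (decayBound_recB R ha hκ hrate hKP δ θ cH W)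
    (operatorRate_wModel R hδ hθ W) (insertionRate_wModel R W _ θ)
    (insAffine_wModel R W) (insBlind_wModel R W) (insHomog_wModel R W) (insScaleBound_wModel R hcH W 1)
    one_pos (by rw [add_zero]; exact hδ) hθ hθθ' hθ'1 hcH one_half_pos one_half_lt_one hnear' le_rfl hfirst hS'⟩

/-- **NON-DEGENERATE LETTERS EXIST FOR EVERY TARGET RATE `θ′ ∈ (½, 1]`**: explicit POSITIVE `a` (activity constant), `δ` (operator
separation of the runs), `c_H` (history gain) satisfying the clauses of `end_fires` with `θ := θ′` — for every pair of runs, window and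
`κ ≥ 0` the H-layer END fires with nonzero activities, genuinely different runs and nonzero history feedback. [folklore] -/
theorem exists_end_fires (W : Set (ℕ → ℝ)) {κ θ' : ℝ} (hκ : 0 ≤ κ) (hθ' : 1 / 2 < θ') (hθ'1 : θ' ≤ 1) :
    ∃ a δ cH : ℝ, 0 < a ∧ 0 < δ ∧ 0 < cH ∧ ∃ C₅ : ℝ,
      NE5 (recA (wModel R a (κ + 2 * (64 * Real.log 162) + 2) κ δ θ' cH))
        (recB (wModel R a (κ + 2 * (64 * Real.log 162) + 2) κ δ θ' cH)) W κ θ' C₅ := by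
  have hK : 0 < K₀ 64 8 := K₀_pos 64 8
  obtain ⟨E, hE, hEpos⟩ : ∃ E : ℝ, E = Real.exp 1 * 9 * 64 * K₀ 64 8 ^ 2 ∧ 0 < E := ⟨_, rfl, by positivity⟩
  obtain ⟨P, hP, hPpos⟩ : ∃ P : ℝ, P = Real.exp (5 * κ + 1) * K₀ 64 8 * 9 * 64 ∧ 0 < P := ⟨_, rfl, by positivity⟩
  have hθpos : 0 < θ' - 1 / 2 := sub_pos.2 hθ'
  obtain ⟨a, ha⟩ : ∃ a : ℝ, a = min (1 / (P + 1)) ((θ' - 1 / 2) / (8 * (E + 1))) := ⟨_, rfl⟩  -- below all three thresholds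
  have ha_pos : 0 < a := by rw [ha]; exact lt_min (div_pos one_pos (by linarith)) (div_pos hθpos (by positivity))
  have ha1 : a ≤ 1 / (P + 1) := by rw [ha]; exact min_le_left _ _
  have ha2 : a ≤ (θ' - 1 / 2) / (8 * (E + 1)) := by rw [ha]; exact min_le_right _ _
  have hEa : E * a ≤ (θ' - 1 / 2) / 8 := by
    refine (mul_le_mul_of_nonneg_left ha2 hEpos.le).trans ?_
    rw [mul_div_assoc', div_le_iff₀ (by positivity : (0 : ℝ) < 8 * (E + 1))]
    nlinarith
  have hPa : a * P ≤ 1 := by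
    refine (mul_le_mul_of_nonneg_right ha1 hPpos.le).trans ?_
    rw [div_mul_eq_mul_div, one_mul, div_le_one (by linarith)]
    linarith
  refine ⟨a, 1 / 4, 1, ha_pos, by norm_num, one_pos, ?_⟩
  refine end_fires R ha_pos.le hκ (by norm_num) (by linarith) le_rfl hθ'1 zero_le_one ?_ ?_ ?_
  · calc a * Real.exp (5 * κ + 1) * K₀ 64 8 * 9 * 64 = a * P := by rw [hP]; ring
      _ ≤ 1 := hPa
  · have h4 : (1 : ℝ) / 4 + 1 * (E * a + E * a) / (1 - 1 / 2) = 1 / 4 + 4 * (E * a) := by ring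
    rw [← hE, h4]; linarith
  · rw [← hE]; linarith

end Summit.QuantumFields.BalabanUV.T4Continuum.Spine.NE5.EnvelopeOnRecordWitness
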